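import Summits.BirchSwinnertonDyer.BirchSwinnertonDyer.Theorems.ThetaPartnerAtTwoSignedKatoUpToAtTwoMultiplierAvoidanceAtTwo
import Summits.BirchSwinnertonDyer.BirchSwinnertonDyer.Theorems.ThetaPartnerAtTwoSignedKatoUpToAtTwoCuspFactorCharacter
import HarnessLib

/-!
# Route `ThetaPartnerAtTwo` (TP2), crux K3 `SignedKatoDivisibilityUpToAtTwo` (stmt-BirchSwinnertonDyer-20308 / K3P′ 25631), line
# `colemanrat` v13, assembly glue G1 — the FINAL `(μ, ν)` PACKAGING: from a value law
# `P_n(χ) = q · μ̃(χ(γ) − 1) · R_n(χ)` (`q ∈ ℚˣ`, `μ̃ ∈ Λ ∖ 𝔭`) to the `∃ μ ν ∉ 𝔭` clause of CORE_χ^prim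

Width seat `bsd-wall-tp2-p2x-w3` g7 (cell `bsd-wall`); memo `Cruxes/SignedKatoDivisibilityUpToAtTwo/G7-ASSEMBLY-v1.md` §0 step 5
(«`P_n(χ) = 3κ_K · R⁻(χ) · ratTwistedSymbolSum f χ` … **`ν := D·κ_den`, `μ := 3κ_num·μ̃`**, `ν ∉ 𝔭` automatically (2 ∉ 𝔭, odd
integers are units)»). HONEST FRAMING: theorems only (no definition, no named fact, no instance, no `sorry`); pure bookkeeping in
`Λ = ℤ₂⟦T⟧` and `ℂ₂`; closes no item; K3 / K3P′ are NOT settled and BSD is NOT proved by any of this.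

## What

The hypothesis of `CoreChi.coreChi_of_coreChiPrim` (CORE_χ^prim, `…CoreOfPrimitiveCharValues`) ends in
`∃ μ ν : IwasawaAlgebra 2, μ ∉ 𝔭 ∧ ν ∉ 𝔭 ∧ ∀ n χ (even, 2-power order, primitive ∨ n ≤ 1), ν(χ)·P_n(χ) = μ(χ)·ratTwistedSymbolSum f χ`
with `F(χ) := ∑' k ι(coeff k F)·(χ(γ) − 1)^k` (`ι : ℤ₂ → ℚ₂ → ℂ₂`, `γ = cyclotomicGenerator 2 = 5`). The assembly (bricks B1–B5, D1–D3)
delivers the values in the shape `P_n(χ) = q · μ̃(χ) · R_n(χ)` with ONE rational constant `q ≠ 0` (`3κ_K/D`, bricks B3/B1′) and ONE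
element `μ̃ ∈ Λ`, `μ̃ ∉ 𝔭` (the four-term cusp element of brick B1 / `MultAvoid.exists_fourTerm_not_mem`). This file turns that shape
into the `∃ μ ν` clause: **`ν := C q.den`, `μ := C q.num · μ̃`**.

* §1 `tsum_coeff_C_mul_eq` — `(C a · F)(z) = ι a · F(z)` (any `z`, no convergence needed: `tsum_mul_left`); `tsum_coeff_C_eq_natCast/intCast`.
* §2 `C_natCast_not_mem`, `C_intCast_not_mem`, `C_intCast_mul_not_mem` — non-zero integers and their products with `μ̃ ∉ 𝔭` avoid a prime
  `𝔭 ∌ 2` (w5 g0's `MultAvoid.C_not_mem_of_ne_zero`).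
* §3 **`exists_mu_nu_of_forall_eq_ratCast_mul`** — the packaging, for ARBITRARY value functions `P R` and side condition `S` on the
  socket's binders `(n, χ : DirichletCharacter ℂ₂ (2^{n+e₀}))`; and `exists_mu_nu_of_forall_eq_ratCast_mul₃`, the same with the three
  curried hypotheses `χ.Even → (∃ j, orderOf χ = 2^j) → (χ.IsPrimitive ∨ n ≤ 1)` of CORE_χ^prim literally.

References: K. Kato, Astérisque 295 (2004) Thm. 12.5 (1), §13.12 [Kato2004Asterisque]; L. Washington, *Introduction to cyclotomic
fields* (1997) §13.2 [Washington1997].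
-/

set_option autoImplicit false
-- the Theorems namespace of this sub repeats the summit name by design (D-0017 nested layout)
set_option linter.dupNamespace false

noncomputable section

open scoped BigOperators

open Literature.NumberTheory.EllipticCurves

namespace Summit.BirchSwinnertonDyer.BirchSwinnertonDyer.Theorems.SignedKatoOffTwo.Packaging

/-! ## §1 Values of `C a · F` and of constants -/

section Values

variable {p : ℕ} [Fact p.Prime]

/-- **`(C a · F)(z) = ι a · F(z)`** for the coefficientwise evaluation `F(z) = ∑' k ι(coeff k F)·z^k` (no convergence hypothesis:
`tsum_mul_left`). [folklore] -/
theorem tsum_coeff_C_mul_eq (a : ℤ_[p]) (F : PowerSeries ℤ_[p]) (z : ℂ_[p]) :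
    ∑' k, ((algebraMap ℚ_[p] ℂ_[p]).comp (algebraMap ℤ_[p] ℚ_[p])) (PowerSeries.coeff k (PowerSeries.C a * F)) * z ^ k =
      ((algebraMap ℚ_[p] ℂ_[p]).comp (algebraMap ℤ_[p] ℚ_[p])) a *
        ∑' k, ((algebraMap ℚ_[p] ℂ_[p]).comp (algebraMap ℤ_[p] ℚ_[p])) (PowerSeries.coeff k F) * z ^ k := by
  rw [← tsum_mul_left]
  exact tsum_congr fun k ↦ by rw [PowerSeries.coeff_C_mul, map_mul, mul_assoc]

/-- The value of the constant `C n`, `n ∈ ℕ`, is `n`. [folklore] -/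
theorem tsum_coeff_C_natCast_eq (n : ℕ) (z : ℂ_[p]) :
    ∑' k, ((algebraMap ℚ_[p] ℂ_[p]).comp (algebraMap ℤ_[p] ℚ_[p])) (PowerSeries.coeff k (PowerSeries.C (n : ℤ_[p]))) * z ^ k =
      (n : ℂ_[p]) := by
  rw [CuspEval.tsum_coeff_C, map_natCast]

/-- The value of the constant `C n`, `n ∈ ℤ`, is `n`. [folklore] -/
theorem tsum_coeff_C_intCast_eq (n : ℤ) (z : ℂ_[p]) :
    ∑' k, ((algebraMap ℚ_[p] ℂ_[p]).comp (algebraMap ℤ_[p] ℚ_[p])) (PowerSeries.coeff k (PowerSeries.C (n : ℤ_[p]))) * z ^ k =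
      (n : ℂ_[p]) := by
  rw [CuspEval.tsum_coeff_C, map_intCast]

end Values

/-! ## §2 Non-zero integers avoid a prime `𝔭 ∌ 2` of `Λ` -/

section Avoid

variable (𝔭 : PrimeSpectrum (IwasawaAlgebra 2)) (h2 : PowerSeries.C (2 : ℤ_[2]) ∉ 𝔭.asIdeal)
include h2

/-- A non-zero natural number is not in a prime `𝔭 ∌ 2` of `ℤ₂⟦T⟧` (`n = 2^v·u`, `u ∈ ℤ₂ˣ`). [cite: Washington1997, §13.2] -/
theorem C_natCast_not_mem {n : ℕ} (hn : n ≠ 0) : PowerSeries.C ((n : ℤ_[2])) ∉ 𝔭.asIdeal :=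
  MultAvoid.C_not_mem_of_ne_zero h2 (Nat.cast_ne_zero.mpr hn)

/-- A non-zero integer is not in a prime `𝔭 ∌ 2` of `ℤ₂⟦T⟧`. [cite: Washington1997, §13.2] -/
theorem C_intCast_not_mem {n : ℤ} (hn : n ≠ 0) : PowerSeries.C ((n : ℤ_[2])) ∉ 𝔭.asIdeal :=
  MultAvoid.C_not_mem_of_ne_zero h2 (Int.cast_ne_zero.mpr hn)

/-- `C n · μ̃ ∉ 𝔭` for a non-zero integer `n` and `μ̃ ∉ 𝔭` (`𝔭` prime, `2 ∉ 𝔭`). [cite: Washington1997, §13.2] -/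
theorem C_intCast_mul_not_mem {n : ℤ} (hn : n ≠ 0) {μt : IwasawaAlgebra 2} (hμt : μt ∉ 𝔭.asIdeal) :
    PowerSeries.C ((n : ℤ_[2])) * μt ∉ 𝔭.asIdeal := fun h ↦
  (𝔭.isPrime.mem_or_mem h).elim (C_intCast_not_mem 𝔭 h2 hn) hμt

end Avoid

/-! ## §3 The packaging `ν := C q.den`, `μ := C q.num · μ̃` -/

section Packaging

variable (𝔭 : PrimeSpectrum (IwasawaAlgebra 2)) (h2 : PowerSeries.C (2 : ℤ_[2]) ∉ 𝔭.asIdeal)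
include h2

/-- **`(μ, ν)` packaging for the CORE_χ^prim clause.** Let `𝔭 ∌ 2` be a prime of `Λ = ℤ₂⟦T⟧`, `μ̃ ∈ Λ ∖ 𝔭`, `q ∈ ℚˣ`, and let
`P, R` be any value functions on the socket binders `(n, χ)` (`χ : DirichletCharacter ℂ₂ (2^{n+e₀})`) with a side condition `S`, such
that `P n χ = q · μ̃(χ) · R n χ` whenever `S n χ`, where `F(χ) = ∑' k ι(coeff k F)·(χ(γ) − 1)^k`. Then `ν := C q.den ∉ 𝔭`,
`μ := C q.num · μ̃ ∉ 𝔭` and `ν(χ)·P n χ = μ(χ)·R n χ` whenever `S n χ` (`q.den · q = q.num`). This is the last step of the K3 assembly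
(memo G7-ASSEMBLY-v1 §0.5: `ν := D·κ_den`, `μ := 3κ_num·μ̃`). [cite: Kato2004Asterisque, Thm. 12.5 (1) (pp. 221–222)] -/
theorem exists_mu_nu_of_forall_eq_ratCast_mul {μt : IwasawaAlgebra 2} (hμt : μt ∉ 𝔭.asIdeal) {q : ℚ} (hq : q ≠ 0)
    (S : (n : ℕ) → DirichletCharacter ℂ_[2] (2 ^ (n + cyclotomicExponent 2)) → Prop)
    (P R : (n : ℕ) → DirichletCharacter ℂ_[2] (2 ^ (n + cyclotomicExponent 2)) → ℂ_[2])
    (hval : ∀ (n : ℕ) (χ : DirichletCharacter ℂ_[2] (2 ^ (n + cyclotomicExponent 2))), S n χ →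
      P n χ = (q : ℂ_[2]) *
        (∑' k, ((algebraMap ℚ_[2] ℂ_[2]).comp (algebraMap ℤ_[2] ℚ_[2])) (PowerSeries.coeff k μt) *
          (χ (cyclotomicGenerator 2 : ZMod (2 ^ (n + cyclotomicExponent 2))) - 1) ^ k) * R n χ) :
    ∃ μ ν : IwasawaAlgebra 2, μ ∉ 𝔭.asIdeal ∧ ν ∉ 𝔭.asIdeal ∧
      ∀ (n : ℕ) (χ : DirichletCharacter ℂ_[2] (2 ^ (n + cyclotomicExponent 2))), S n χ →
        (∑' k, ((algebraMap ℚ_[2] ℂ_[2]).comp (algebraMap ℤ_[2] ℚ_[2])) (PowerSeries.coeff k ν) *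
            (χ (cyclotomicGenerator 2 : ZMod (2 ^ (n + cyclotomicExponent 2))) - 1) ^ k) * P n χ =
          (∑' k, ((algebraMap ℚ_[2] ℂ_[2]).comp (algebraMap ℤ_[2] ℚ_[2])) (PowerSeries.coeff k μ) *
            (χ (cyclotomicGenerator 2 : ZMod (2 ^ (n + cyclotomicExponent 2))) - 1) ^ k) * R n χ := by
  have hnum : q.num ≠ 0 := Rat.num_ne_zero.mpr hq
  refine ⟨PowerSeries.C ((q.num : ℤ_[2])) * μt, PowerSeries.C (((q.den : ℤ) : ℤ_[2])),
    C_intCast_mul_not_mem 𝔭 h2 hnum hμt, C_intCast_not_mem 𝔭 h2 (Int.natCast_ne_zero.mpr q.den_ne_zero), fun n χ hS ↦ ?_⟩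
  set z : ℂ_[2] := χ (cyclotomicGenerator 2 : ZMod (2 ^ (n + cyclotomicExponent 2))) - 1 with hz
  set M : ℂ_[2] := ∑' k, ((algebraMap ℚ_[2] ℂ_[2]).comp (algebraMap ℤ_[2] ℚ_[2])) (PowerSeries.coeff k μt) * z ^ k with hM
  rw [tsum_coeff_C_intCast_eq, tsum_coeff_C_mul_eq, ← hM, map_intCast, hval n χ hS, ← hM]
  have hqd : (q : ℂ_[2]) * ((q.den : ℤ) : ℂ_[2]) = (q.num : ℂ_[2]) := by
    have h := Rat.mul_den_eq_num q
    rw [Int.cast_natCast]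
    exact_mod_cast congrArg (fun r : ℚ ↦ (r : ℂ_[2])) h
  linear_combination (M * R n χ) * hqd

/-- **`(μ, ν)` packaging, CORE_χ^prim binders literally.** As `exists_mu_nu_of_forall_eq_ratCast_mul` with the side condition spelled as
the three curried hypotheses `χ.Even → (∃ j, orderOf χ = 2^j) → (χ.IsPrimitive ∨ n ≤ 1)` of the (ERL_χ) clause of
`CoreChi.coreChi_of_coreChiPrim`; take `R n χ := ratTwistedSymbolSum f χ` and `P n χ :=` the `pairingSum` value to obtain that clause.
[cite: Kato2004Asterisque, Thm. 12.5 (1) (pp. 221–222)] -/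
theorem exists_mu_nu_of_forall_eq_ratCast_mul₃ {μt : IwasawaAlgebra 2} (hμt : μt ∉ 𝔭.asIdeal) {q : ℚ} (hq : q ≠ 0)
    (P R : (n : ℕ) → DirichletCharacter ℂ_[2] (2 ^ (n + cyclotomicExponent 2)) → ℂ_[2])
    (hval : ∀ (n : ℕ) (χ : DirichletCharacter ℂ_[2] (2 ^ (n + cyclotomicExponent 2))),
      χ.Even → (∃ j : ℕ, orderOf χ = 2 ^ j) → (χ.IsPrimitive ∨ n ≤ 1) →
      P n χ = (q : ℂ_[2]) *
        (∑' k, ((algebraMap ℚ_[2] ℂ_[2]).comp (algebraMap ℤ_[2] ℚ_[2])) (PowerSeries.coeff k μt) *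
          (χ (cyclotomicGenerator 2 : ZMod (2 ^ (n + cyclotomicExponent 2))) - 1) ^ k) * R n χ) :
    ∃ μ ν : IwasawaAlgebra 2, μ ∉ 𝔭.asIdeal ∧ ν ∉ 𝔭.asIdeal ∧
      ∀ (n : ℕ) (χ : DirichletCharacter ℂ_[2] (2 ^ (n + cyclotomicExponent 2))),
        χ.Even → (∃ j : ℕ, orderOf χ = 2 ^ j) → (χ.IsPrimitive ∨ n ≤ 1) →
        (∑' k, ((algebraMap ℚ_[2] ℂ_[2]).comp (algebraMap ℤ_[2] ℚ_[2])) (PowerSeries.coeff k ν) *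
            (χ (cyclotomicGenerator 2 : ZMod (2 ^ (n + cyclotomicExponent 2))) - 1) ^ k) * P n χ =
          (∑' k, ((algebraMap ℚ_[2] ℂ_[2]).comp (algebraMap ℤ_[2] ℚ_[2])) (PowerSeries.coeff k μ) *
            (χ (cyclotomicGenerator 2 : ZMod (2 ^ (n + cyclotomicExponent 2))) - 1) ^ k) * R n χ := by
  obtain ⟨μ, ν, hμ, hν, h⟩ := exists_mu_nu_of_forall_eq_ratCast_mul 𝔭 h2 hμt hq
    (fun n χ ↦ χ.Even ∧ (∃ j : ℕ, orderOf χ = 2 ^ j) ∧ (χ.IsPrimitive ∨ n ≤ 1)) P R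
    (fun n χ hS ↦ hval n χ hS.1 hS.2.1 hS.2.2)
  exact ⟨μ, ν, hμ, hν, fun n χ hev hord hb ↦ h n χ ⟨hev, hord, hb⟩⟩

end Packaging

end Summit.BirchSwinnertonDyer.BirchSwinnertonDyer.Theorems.SignedKatoOffTwo.Packaging

end
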